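import Summits.KontsevichZagierPeriods.KontsevichZagierPeriods.Theorems.SoloBlindGreenDatum
import HarnessLib

/-!
# Green's formula on the half-plane inside the rules, II: the route through `x` — `[D, h] ≡ [(0,∞), P(½,y)]`

For a `GreenDatum` `g` on `D = {x < ½, y > 0}`, `h = Re g' = ∂P/∂x` (`P = Re g`).  Integrating
first in `x` over the fibres `(-∞, ½) × {y}` is one Newton–Leibniz move (rule (3)) once the fibre
is compactified by the rational chart `x = ½ - u/(1-u)`, `u ∈ (0,1)` (rule (2), `chartB` of
`SoloBlindCauchyChartB`): the fibre primitive is `-P(x(u), y)`, continuous on `[0,1]` with value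
`-P(½, y)` at `u = 0` and limit `0` at `u = 1` (`g → 0` as `x → -∞`).  Hence
`[D, h] ≡ [(0,∞) × [0,1], f_B] ≡ [(0,∞), P(½, y)]`: `GreenDatum.rep_sub_midRep`.

References: Kontsevich–Zagier, *Periods* (2001), §1.2 (rules (1)–(3)).
-/

noncomputable section

open Set Complex MeasureTheory Filter
open scoped Topology
open Literature.ModelTheory.ExponentialFields MvPolynomial
open Literature.NumberTheory.Transcendental
open Literature.NumberTheory.Transcendental.KZ

namespace Summit.KontsevichZagierPeriods.KontsevichZagierPeriods.Theorems

namespace SoloBlind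

namespace GreenDatum

variable (D : GreenDatum)

/-! ## The transported integrand and the fibre primitive -/

/-- `f_B(y,u) = h(Φ_B(y,u)) m'(u)` (`u < 1`), `0` on the edge `u = 1`. -/
def fB (w : Fin 2 → ℝ) : ℝ := if w 1 < 1 then D.H (chartB w) / (1 - w 1) ^ 2 else 0

/-- `F_B(y,u) = -P(Φ_B(y,u))` (`u < 1`), `0` on the edge `u = 1`. -/
def FB (w : Fin 2 → ℝ) : ℝ := if w 1 < 1 then -D.P (chartB w) else 0

/-- `f_B` is `ℚ`-semialgebraic on the closed band. -/
theorem sa_fB : IsSemialgebraicFunOn ℚ bandB D.fB := by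
  have hne : ∀ w ∈ {w : Fin 2 → ℝ | 0 < w 0 ∧ 0 ≤ w 1 ∧ w 1 < 1}, w 1 ≠ 1 :=
    fun w hw => ne_of_lt hw.2.2
  have hf₁ : IsSemialgebraicFunOn ℚ {w : Fin 2 → ℝ | 0 < w 0 ∧ 0 ≤ w 1 ∧ w 1 < 1}
      (fun w => D.H (chartB w) / (1 - w 1) ^ 2) :=
    ((D.sa_h.comp_isSemialgebraicMapOn_holds
      (isSemialgebraicMapOn_chartB isSemialgebraic_bandB₁ hne) chartB_mapsTo).fun_mul
      (isSemialgebraicFunOn_aeval_div_aeval isSemialgebraic_bandB₁ 1 ((1 - X 1) ^ 2)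
        fun w hw => by
          simpa [sub_eq_zero] using pow_ne_zero 2 (sub_ne_zero.mpr (hne w hw).symm))).congr
      fun w _ => by
        simp only [Function.comp, H, map_one, map_pow, map_sub, MvPolynomial.aeval_X]; ring
  have hf₂ : IsSemialgebraicFunOn ℚ {w : Fin 2 → ℝ | 0 < w 0 ∧ 1 ≤ w 1 ∧ w 1 ≤ 1}
      (fun _ => (0 : ℝ)) :=
    (isSemialgebraicFunOn_aeval isSemialgebraic_bandB₂ (0 : MvPolynomial (Fin 2) ℚ)).congr
      fun _ _ => by simp
  rw [bandB_eq_union]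
  exact hf₁.union hf₂ (fun w hw => if_pos hw.2.2) (fun w hw => if_neg (not_lt.mpr hw.2.1))

/-- `F_B` is `ℚ`-semialgebraic on the closed band. -/
theorem sa_FB : IsSemialgebraicFunOn ℚ bandB D.FB := by
  have hne : ∀ w ∈ {w : Fin 2 → ℝ | 0 < w 0 ∧ 0 ≤ w 1 ∧ w 1 < 1}, w 1 ≠ 1 :=
    fun w hw => ne_of_lt hw.2.2
  have hf₁ : IsSemialgebraicFunOn ℚ {w : Fin 2 → ℝ | 0 < w 0 ∧ 0 ≤ w 1 ∧ w 1 < 1}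
      (fun w => -D.P (chartB w)) :=
    (D.sa_re.comp_isSemialgebraicMapOn_holds
      (isSemialgebraicMapOn_chartB isSemialgebraic_bandB₁ hne) chartB_mapsTo).fun_neg.congr
      fun w _ => by simp only [Function.comp, P]
  have hf₂ : IsSemialgebraicFunOn ℚ {w : Fin 2 → ℝ | 0 < w 0 ∧ 1 ≤ w 1 ∧ w 1 ≤ 1}
      (fun _ => (0 : ℝ)) :=
    (isSemialgebraicFunOn_aeval isSemialgebraic_bandB₂ (0 : MvPolynomial (Fin 2) ℚ)).congr
      fun _ _ => by simp
  rw [bandB_eq_union]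
  exact hf₁.union hf₂ (fun w hw => if_pos hw.2.2) (fun w hw => if_neg (not_lt.mpr hw.2.1))

/-- `f_B` is absolutely integrable on the open band (transport from `[D, h]`). -/
theorem integrableOn_fB : IntegrableOn D.fB openBandB := by
  have h := (integrableOn_iff_of_chart (S := openBandB) (Φ := chartB) (Φ' := chartBDeriv)
    (J := fun w => 1 / (1 - w 1) ^ 2) (f := D.fB) (g := D.H) isOpen_openBandB.measurableSet
    (fun w hw => hasFDerivAt_chartB (ne_of_lt hw.2.2)) (injOn_chartB.mono fun w hw => hw.2.2)
    (fun w _ => abs_det_chartBDeriv w) (fun w hw => by simp [fB, hw.2.2, div_eq_mul_inv])).mp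
  rw [image_chartB] at h
  exact h D.rep.integrableOn

/-! ## The representations and the moves -/

/-- **`[(0,∞) × [0,1], f_B]`**, the band form of `[D, h]`. -/
def bandRepB : IntegralRep 2 where
  domain := bandB
  integrand := D.fB
  isSemialgebraic_domain := isSemialgebraic_bandB
  isSemialgebraicFunOn_integrand := D.sa_fB
  integrableOn := D.integrableOn_fB.congr_set_ae
    (ae_eq_set.2 ⟨volume_bandB_diff,
      measure_mono_null (fun _ hw => hw.2 (openBandB_subset_bandB hw.1)) measure_empty⟩)

/-- **`[(0,∞) × (0,1), f_B]`**, its restriction to the open band. -/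
def openBandRepB : IntegralRep 2 :=
  D.bandRepB.restrict openBandB isSemialgebraic_openBandB openBandB_subset_bandB

/-- **Rule (3) in `u`**: `[(0,∞) × [0,1], f_B] - [(0,∞), F_B(y,1) - F_B(y,0)]` is a relation,
and `F_B(y,1) - F_B(y,0) = 0 - (-P(½,y))`. -/
theorem bandRepB_sub_midRep : of D.bandRepB - of D.midRep ∈ relations := by
  have e0 : ∀ (x : Fin 1 → ℝ) (t : ℝ), (Fin.snoc x t : Fin 2 → ℝ) 0 = x 0 := fun _ _ => rfl
  have e1 : ∀ (x : Fin 1 → ℝ) (t : ℝ), (Fin.snoc x t : Fin 2 → ℝ) 1 = t := fun _ _ => rfl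
  have hch : ∀ (x : Fin 1 → ℝ) (t : ℝ), chartB (Fin.snoc x t) = ![1 / 2 - moeb t, x 0] :=
    fun x t => by funext i; fin_cases i <;> simp [chartB, e0, e1]
  have hdom : ∀ x ∈ D.midRep.domain, 0 < x 0 := fun x hx => by
    simpa [midRep, mem_line] using hx
  have hxt : Tendsto (fun t : ℝ => 1 / 2 - moeb t) (𝓝[<] (1 : ℝ)) atBot := by
    have h := tendsto_atBot_add_const_right _ (1 / 2 : ℝ)
      (tendsto_neg_atTop_atBot.comp tendsto_moeb_one)
    refine h.congr' (Eventually.of_forall fun t => ?_)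
    simp only [Function.comp]
    ring
  refine newtonLeibnizRel_subset_relations ⟨1, D.bandRepB, D.midRep, fun _ => 0, fun _ => 1,
    D.FB, D.sa_FB,
    isSemialgebraicFunOn_const_of_isAlgebraic D.midRep.isSemialgebraic_domain isAlgebraic_zero,
    isSemialgebraicFunOn_const_of_isAlgebraic D.midRep.isSemialgebraic_domain isAlgebraic_one,
    fun _ _ => zero_le_one, ?_, ?_, ?_, ?_, rfl⟩
  · ext z
    simp only [bandRepB, bandB, mem_setOf_eq, midRep, lineRep_domain, mem_line, mem_Ioi,
      Fin.init, Fin.castSucc_zero, show (Fin.last 1 : Fin 2) = 1 from rfl]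
  · intro x hx
    have hy := hdom x hx
    have hG : ∀ t : ℝ, D.FB (Fin.snoc x t) =
        if t < 1 then -(D.g ((1 / 2 - moeb t : ℝ) + x 0 * I)).re else 0 := by
      intro t
      rw [FB, e1, hch, (D.PQH_apply _ _).1]
    simp only [hG]
    refine continuousOn_Icc_of_tendsto ?_ (by simp) ?_
    · refine ContinuousOn.congr (f := fun t : ℝ =>
        -(D.g ((1 / 2 - moeb t : ℝ) + x 0 * I)).re) ?_ fun t ht => if_pos ht.2
      intro t ht
      have h1 : ContinuousAt (fun s : ℝ => 1 / 2 - moeb s) t :=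
        ((hasDerivAt_moeb (ne_of_lt ht.2)).continuousAt).const_sub _
      have h2 := D.continuousAt_dx (x := 1 / 2 - moeb t) (y := x 0)
        (by linarith [moeb_nonneg ht.1 ht.2]) hy
      exact (Complex.continuous_re.continuousAt.comp
        (ContinuousAt.comp (f := fun s : ℝ => 1 / 2 - moeb s) h2 h1)).neg.continuousWithinAt
    · have hT : Tendsto (fun t : ℝ => -(D.g ((1 / 2 - moeb t : ℝ) + x 0 * I)).re)
          (𝓝[<] (1 : ℝ)) (𝓝 0) := by
        have h := ((Complex.continuous_re.tendsto 0).comp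
          ((D.tendsto_atBot (x 0) hy).comp hxt)).neg
        simpa using h
      refine hT.congr' ?_
      filter_upwards [self_mem_nhdsWithin] with t ht
      rw [if_pos (mem_Iio.mp ht)]
  · intro x hx t ht
    have hy := hdom x hx
    have hφ : HasDerivAt (fun s : ℝ => 1 / 2 - moeb s) (-(1 / (1 - t) ^ 2)) t :=
      (hasDerivAt_moeb (ne_of_lt ht.2)).const_sub _
    have h2 := D.hasDerivAt_re_dx (x := 1 / 2 - moeb t) (y := x 0)
      (by linarith [moeb_nonneg ht.1.le ht.2]) hy
    have hcomp : HasDerivAt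
        (fun s : ℝ => -(D.g (((1 / 2 - moeb s : ℝ) : ℂ) + x 0 * I)).re)
        (-((D.g' (((1 / 2 - moeb t : ℝ) : ℂ) + x 0 * I)).re * (-(1 / (1 - t) ^ 2)))) t := by
      have h := HasDerivAt.comp t h2 hφ
      exact h.neg
    have hev : (fun s : ℝ => D.FB (Fin.snoc x s)) =ᶠ[nhds t]
        fun s : ℝ => -(D.g (((1 / 2 - moeb s : ℝ) : ℂ) + x 0 * I)).re := by
      filter_upwards [Iio_mem_nhds ht.2] with s hs
      rw [FB, e1, if_pos (show s < 1 from hs), hch, (D.PQH_apply _ _).1]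
    refine (hcomp.congr_of_eventuallyEq hev).congr_deriv ?_
    show _ = D.fB (Fin.snoc x t)
    rw [fB, e1, if_pos ht.2, hch, (D.PQH_apply _ _).2.2]
    ring
  · intro x hx
    simp only [midRep, lineRep_integrand, mid]
    rw [FB, FB, e1, e1, if_neg (lt_irrefl _), if_pos zero_lt_one, hch, moeb_zero, sub_zero]
    ring

/-- **Rule (2) along `Φ_B`**: `[(0,∞) × (0,1), f_B] ≡ [D, h]`. -/
theorem openBandRepB_equivalent : Equivalent D.openBandRepB D.rep :=
  equivalent_of_chart (f := D.fB) (g := D.H) (J := fun w => 1 / (1 - w 1) ^ 2)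
    (isSemialgebraicMapOn_chartB isSemialgebraic_openBandB fun w hw => ne_of_lt hw.2.2)
    (fun w hw => hasFDerivAt_chartB (ne_of_lt hw.2.2)) (injOn_chartB.mono fun w hw => hw.2.2)
    image_chartB (fun w _ => abs_det_chartBDeriv w)
    (fun w hw => by simp [fB, hw.2.2, div_eq_mul_inv]) rfl (fun _ _ => rfl) rfl (fun _ _ => rfl)

/-- **Green's formula inside the rules, route B: `[D, h] ≡ [(0,∞), P(½, y)]`.** -/
theorem rep_sub_midRep : of D.rep - of D.midRep ∈ relations := by
  have h1 := D.bandRepB_sub_midRep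
  have h2 : of D.bandRepB - of D.openBandRepB ∈ relations :=
    D.bandRepB.of_sub_of_restrict_mem_relations isSemialgebraic_openBandB
      openBandB_subset_bandB volume_bandB_diff
  have h3 : of D.openBandRepB - of D.rep ∈ relations := D.openBandRepB_equivalent
  have h := relations.sub_mem (relations.sub_mem h1 h2) h3
  convert h using 1
  abel

end GreenDatum

end SoloBlind

end Summit.KontsevichZagierPeriods.KontsevichZagierPeriods.Theorems
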